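import Literature.MathematicalPhysics.QuantumFieldTheory.QCDSiteRPFrame
import Literature.MathematicalPhysics.QuantumLattice.GrassmannBlockProjection
import HarnessLib

/-!
# The positive block and the block split of the rotated Wilson quark action

Companion of `QCDSiteRPFrame` (generator bookkeeping in the `γ₀`-diagonal frame: `reflGen`, `genSign`,
`genTimeT`, `posGens`/`negGens`/`zeroGens`, `upperGens`/`lowerGens`, `fermiThetaRot_gen`,
`spinUnrot_quadratic`) and of `GrassmannBlockProjection` (block projections `blockProj` and their
intertwining with a generator-permuting reflection).  For the site-reflection positivity proof of
Montvay–Münster §4.2.3 (4.100)–(4.106) on the odd torus `L = 2S+1`: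

* `posBlock Nf L = posGens ∪ upperGens` — **the positive block** `𝓟` (all generators at times
  `1 ≤ t ≤ L/2` and the upper slice-`0` generators `ξ = P₊ψ₀`, `ηᵀ = −ψ̄₀P₋` of (4.102));
  `mem_posBlock_iff : w ∈ 𝓟 ↔ σ w ∉ 𝓟` and `image_reflGen_posBlock : σ(𝓟) = 𝓟ᶜ` (`L` odd);
* `rotAction mq V = R' (ψ̄ (−D^{AP}(V)) ψ)` — the antiperiodic Wilson quark action in the rotated
  generators (`spinUnrot_fermiBoltzmannAP : R' e^{−ψ̄D^{AP}ψ} = exp (rotAction)`), its reflection symmetry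
  `fermiThetaRot_rotAction : Θ' (S(V)) = S(Θ'V)` (transport of `thetaMatrix_diracMatrixAP`);
* `posAction`, `negAction` — its `𝓟`- and `𝓟ᶜ`-blocks, with **`fermiThetaRot_posAction :
  Θ' (S₊(Θ'V)) = S₋(V)`** (Montvay–Münster (4.106)) and `posAction_mem_spectator`.

Everything is proved; no named fact.  The crossing remainder `rotAction − posAction − negAction`
(slice `t = 0` and the antiperiodic layer) is analysed in the sequel.

## Sources

I. Montvay, G. Münster, *Quantum Fields on a Lattice* (CUP 1994), §4.2.3 (4.100)–(4.106);
M. Lüscher, Commun. Math. Phys. 54 (1977) 283, §2; K. Osterwalder, E. Seiler, Ann. Phys. 110 (1978)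
440, §3.
-/

open Literature.Probability Literature.Probability.LatticeModels Literature.MathematicalPhysics.QuantumLattice
open scoped Matrix ComplexConjugate

noncomputable section

namespace Literature.MathematicalPhysics.QuantumFieldTheory

/-! ### The positive block -/

section Blocks

variable {Nf L : ℕ} [NeZero L]

variable (Nf L) in
/-- **The positive block of generators** `𝓟 = posGens ∪ upperGens` (Montvay–Münster (4.100)–(4.102)):
all `ψ, ψ̄` at times `1 ≤ t ≤ L/2`, and on the reflection slice `t = 0` the upper variables
`ξ = P₊ψ₀`, `ηᵀ = −ψ̄₀P₋` — exactly the slice-`0` variables through which the positive-time action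
depends on slice `0`. [cite: MontvayMunster1994, §4.2.3 (4.100)–(4.102)] -/
def posBlock : Finset (FermiIdx Nf L ⊕ₗ FermiIdx Nf L) := posGens Nf L ∪ upperGens Nf L

/-- Membership in the positive block. [folklore] -/
theorem mem_posBlock {w : FermiIdx Nf L ⊕ₗ FermiIdx Nf L} :
    w ∈ posBlock Nf L ↔ (1 ≤ genTimeT w ∧ genTimeT w ≤ L / 2) ∨ (genTimeT w = 0 ∧ IsUpper w) := by
  rw [posBlock, Finset.mem_union, mem_posGens, mem_upperGens]

/-- **On the odd torus, `σ` exchanges the positive block and its complement**: `w ∈ 𝓟 ↔ σ w ∉ 𝓟`. [cite: MontvayMunster1994, §4.2.3 (4.106)] -/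
theorem mem_posBlock_iff (hL : Odd L) (w : FermiIdx Nf L ⊕ₗ FermiIdx Nf L) :
    w ∈ posBlock Nf L ↔ reflGen w ∉ posBlock Nf L := by
  obtain ⟨S, hS⟩ := hL
  have hlt := genTimeT_lt w
  have hdiv : L / 2 = S := by omega
  rw [mem_posBlock, mem_posBlock, genTimeT_reflGen, isUpper_reflGen, hdiv]
  by_cases hu : IsUpper w
  · simp only [hu, not_true, and_false, or_false, and_true]
    by_cases h0 : genTimeT w = 0
    · simp [h0]
    · simp only [if_neg h0]; omega
  · simp only [hu, not_false_iff, and_true, and_false, or_false]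
    by_cases h0 : genTimeT w = 0
    · simp [h0]
    · simp only [if_neg h0]; omega

/-- `σ(𝓟) = 𝓟ᶜ` on the odd torus. [cite: MontvayMunster1994, §4.2.3 (4.106)] -/
theorem image_reflGen_posBlock (hL : Odd L) : (posBlock Nf L).image reflGen = (posBlock Nf L)ᶜ := by
  ext w
  rw [Finset.mem_image, Finset.mem_compl]
  constructor
  · rintro ⟨v, hv, rfl⟩
    exact (mem_posBlock_iff hL v).1 hv
  · intro hw
    refine ⟨reflGen w, ?_, reflGen_reflGen w⟩
    rw [mem_posBlock_iff hL, reflGen_reflGen]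
    exact hw

/-- `Θ'` on the generators of `𝓟`, in the form consumed by `GrassmannReflectionPositivity`. [folklore] -/
theorem fermiThetaRot_gen_of_mem_posBlock :
    ∀ p ∈ posBlock Nf L, fermiThetaRot (GrassmannAlgebra.gen ℂ p) = genSign p • GrassmannAlgebra.gen ℂ (reflGen p) :=
  fun p _ => fermiThetaRot_gen p

/-- `σ` is injective on `𝓟`. [folklore] -/
theorem injOn_reflGen_posBlock :
    Set.InjOn reflGen (↑(posBlock Nf L) : Set (FermiIdx Nf L ⊕ₗ FermiIdx Nf L)) :=
  reflGen_injective.injOn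

end Blocks

/-! ### The rotated action and its blocks -/

section Action

local notation "𝔾" => Matrix.specialUnitaryGroup (Fin 3) ℂ

variable {Nf L : ℕ} [NeZero L]

/-- **The antiperiodic Wilson quark action in the rotated generators**:
`rotAction mq V = R' (ψ̄ (−D^{AP}(V)) ψ)` (`R' = spinUnrot`). [cite: MontvayMunster1994, §4.2.3 (4.100)] -/
def rotAction (mq : Fin Nf → ℝ) (V : GaugeConfig 4 L 𝔾) : FermiAlg Nf L :=
  spinUnrot (quadratic ℂ (-diracMatrixAP V mq))

/-- `R'` of the Boltzmann factor is the exponential of the rotated action. [folklore] -/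
theorem spinUnrot_fermiBoltzmannAP (mq : Fin Nf → ℝ) (V : GaugeConfig 4 L 𝔾) :
    spinUnrot (fermiBoltzmannAP V mq) = grassmannExp (rotAction mq V) := by
  rw [fermiBoltzmannAP, rotAction, spinUnrot,
    GrassmannAlgebra.map_grassmannExp ℂ _ (isNilpotent_quadratic ℂ _)]

/-- The rotated action is the quadratic form of the rotated Dirac matrix `−(1⊗W) D (1⊗W†)`. [folklore] -/
theorem rotAction_eq_quadratic (mq : Fin Nf → ℝ) (V : GaugeConfig 4 L 𝔾) :
    rotAction mq V = quadratic ℂ (-(spinBlock spinW * diracMatrixAP V mq * spinBlock spinWᴴ)) := by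
  rw [rotAction, spinUnrot_quadratic, Matrix.mul_neg, Matrix.neg_mul]

/-- The rotated action is nilpotent. [folklore] -/
theorem isNilpotent_rotAction (mq : Fin Nf → ℝ) (V : GaugeConfig 4 L 𝔾) : IsNilpotent (rotAction mq V) := by
  rw [rotAction_eq_quadratic]
  exact isNilpotent_quadratic ℂ _

/-- The rotated action is even. [folklore] -/
theorem rotAction_mem_evenOdd_zero (mq : Fin Nf → ℝ) (V : GaugeConfig 4 L 𝔾) :
    rotAction mq V ∈ GrassmannAlgebra.evenOdd ℂ (ι := FermiIdx Nf L ⊕ₗ FermiIdx Nf L) 0 := by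
  rw [rotAction_eq_quadratic]
  exact GrassmannAlgebra.quadratic_mem_evenOdd_zero ℂ _

/-- **Reflection symmetry of the rotated action on the odd torus**: `Θ' (S(V)) = S(Θ'V)`,
`Θ'V = GaugeConfig.negReflect V` (transport of the tree's `thetaMatrix_diracMatrixAP`). [cite: MontvayMunster1994, §4.2.3 (4.95) and (4.106)] -/
theorem fermiThetaRot_rotAction (hL : Odd L) (mq : Fin Nf → ℝ) (V : GaugeConfig 4 L 𝔾) :
    fermiThetaRot (rotAction mq V) = rotAction mq V.negReflect := by
  rw [rotAction, ← spinUnrot_torusTheta, torusTheta_quadratic, thetaMatrix_neg, thetaMatrix_diracMatrixAP hL,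
    rotAction]

/-- **The positive-time part `S₊` of the rotated action**: its block on the monomials supported in
`𝓟` (Montvay–Münster (4.100): `S₊[ψ⁺, ψ̄⁺, ξ, η]`). [cite: MontvayMunster1994, §4.2.3 (4.100)] -/
def posAction (mq : Fin Nf → ℝ) (V : GaugeConfig 4 L 𝔾) : FermiAlg Nf L :=
  GrassmannAlgebra.blockProj (posBlock Nf L) (rotAction mq V)

/-- **The negative-time part `S₋`**: the block on the monomials supported in `𝓟ᶜ`. [cite: MontvayMunster1994, §4.2.3 (4.100)] -/
def negAction (mq : Fin Nf → ℝ) (V : GaugeConfig 4 L 𝔾) : FermiAlg Nf L :=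
  GrassmannAlgebra.blockProj (posBlock Nf L)ᶜ (rotAction mq V)

/-- **`Θ' S₊(Θ'V) = S₋(V)`** (Montvay–Münster (4.106)), from the reflection symmetry of the whole
action and `σ(𝓟) = 𝓟ᶜ`. [cite: MontvayMunster1994, §4.2.3 (4.106)] -/
theorem fermiThetaRot_posAction (hL : Odd L) (mq : Fin Nf → ℝ) (V : GaugeConfig 4 L 𝔾) :
    fermiThetaRot (posAction mq V.negReflect) = negAction mq V := by
  unfold posAction negAction
  rw [GrassmannAlgebra.map_blockProj fermiThetaRot fermiThetaRot_gen reflGen_injective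
    (mem_posBlock_iff hL), fermiThetaRot_rotAction hL, WilsonSiteRP.negReflect_negReflect_config]
  convert rfl

/-- `S₊` lies in the positive subalgebra `Λ_𝓟`. [folklore] -/
theorem posAction_mem_spectator (mq : Fin Nf → ℝ) (V : GaugeConfig 4 L 𝔾) :
    posAction mq V ∈ GrassmannAlgebra.spectatorSubalgebra ℂ (posBlock Nf L)ᶜ :=
  GrassmannAlgebra.blockProj_mem_spectator _ _

end Action

end Literature.MathematicalPhysics.QuantumFieldTheory

end
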